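import Literature.RepresentationTheory.FiniteGroups.SymmetricGroupIsotypic
import Literature.NumberTheory.DiophantineGeometry.SymmetricGroupRepsFinrankSpechtProofs
import Mathlib.LinearAlgebra.Matrix.PosDef
import HarnessLib

/-!
# The isotypic projectors `P_λ` of `𝔖ₙ` on the tensor power `(ℂ^N)^{⊗n}` as matrices

Topic `Literature/RepresentationTheory/FiniteGroups`. In the coordinate ("word") model
`Word N n → ℂ = ((Fin n → Fin N) → ℂ)` of `(ℂ^N)^{⊗n}` (tree: `TensorWordModel.lean`; `𝔖ₙ` permutes
the positions, `wordPermRep`, and a matrix `A` acts by its Kronecker power `tensorPowerMatrix A`,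
entries `∏_p A_{w' p, w p}`), the isotypic projector of the irreducible character `χ^λ` of `𝔖ₙ`
(`isotypicProj`, `IsotypicProjector.lean`; `SymmetricGroupIsotypic.lean`) is the matrix
`P_λ = (f^λ/n!) ∑_{t ∈ 𝔖ₙ} χ^λ(t) Π(t⁻¹)` (`wordIsotypicMatrix N n λ`; `Π(σ)` the permutation matrix
`wordPermMatrix σ` of `σ` on words). These are the projectors `P_λ^V ∈ End(V^{⊗n})`,
`V = ℂ^N`, of Christandl–Vrana–Zuiddam, *Universal points in the asymptotic spectrum of tensors*,
J. Amer. Math. Soc. 36 (2023), §3.1 ("the equivariant projection onto the subspace isomorphic to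
`S_λ(V) ⊗ [λ]`"). PROVED here:

* `wordPermMatrix_mul_tensorPowerMatrix` — `Π(σ) A^{⊗n} = A^{⊗n} Π(σ)` for EVERY matrix `A`
  (not only invertible ones), hence `wordIsotypicMatrix_mul_tensorPowerMatrix`:
  `P_λ A^{⊗n} = A^{⊗n} P_λ`;
* `wordIsotypicMatrix_mul_self` (`P_λ² = P_λ`), `wordIsotypicMatrix_mul_of_ne` (`P_λ P_μ = 0`,
  `λ ≠ μ`), `sum_wordIsotypicMatrix` (`∑_{λ ⊢ n} P_λ = 1`) — from the representation-level
  statements of `SymmetricGroupIsotypic.lean`;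
* `conjTranspose_wordIsotypicMatrix` (`P_λᴴ = P_λ`: the Specht characters are real and
  `χ^λ(t⁻¹) = χ^λ(t)`, permutation matrices are real orthogonal), `posSemidef_wordIsotypicMatrix`
  and `posSemidef_one_sub_wordIsotypicMatrix` (`0 ≤ P_λ ≤ 1`);
* `wordIsotypicMatrix_mulVec` (the matrix acts as the projector).

## References

* M. Christandl, P. Vrana, J. Zuiddam, J. Amer. Math. Soc. 36 (2023) = arXiv:1709.07851v3, §3.1
  (Schur–Weyl duality (3.1) and the projectors `P_λ^V`). [ChristandlVranaZuiddam2023]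
* J.-P. Serre, *Linear Representations of Finite Groups*, §2.6 Thm. 8.
  [SerreLinearRepresentations1977]
* W. Fulton, J. Harris, *Representation Theory*, GTM 129, Lemma 6.22 (the actions of `𝔖_d` and
  `GL(V)` on `V^{⊗d}` commute). [FultonHarrisGTM129]

## Mathlib and tree

Mathlib: `LinearMap.toMatrix'` (`toMatrix'_apply`, `toMatrix'_comp`, `toMatrix'_id`,
`toMatrix'_mulVec`), `Matrix.PosSemidef` (`posSemidef_conjTranspose_mul_self`),
`Fintype.prod_equiv`, `Fintype.sum_equiv`, `Equiv.inv`. Tree: `wordPerm`, `wordPermRep`,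
`tensorPowerMatrix`
(`TensorWordModel.lean`, `SymmetricGroupRepsFinrankSpechtProofs.lean`); `isotypicProj_apply`,
`sum_isotypicProj_specht`, `isotypicProj_specht_comp_self/_of_ne`, `spechtCharacter_inv`,
`star_spechtCharacter`.
-/

noncomputable section

open scoped BigOperators Matrix ComplexOrder
open Module
open Literature.NumberTheory.DiophantineGeometry (Word wordPerm wordPerm_apply wordPermRep
  wordPermRep_apply tensorPowerMatrix tensorPowerMatrix_apply spechtCharacter)

namespace Literature.RepresentationTheory.FiniteGroups

variable {N n : ℕ}

/-! ### Permutation matrices on words and the Kronecker power of a matrix -/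

/-- The permutation matrix of `σ ∈ 𝔖ₙ` acting on words by `(σ · c)(w) = c(w ∘ σ)`: the matrix of
the tree's `wordPerm ℂ σ` in the standard basis, entries `Π(σ)_{w', w} = [w = w' ∘ σ]`.
[folklore] -/
def wordPermMatrix (N : ℕ) (σ : Equiv.Perm (Fin n)) : Matrix (Word N n) (Word N n) ℂ :=
  LinearMap.toMatrix' (wordPerm ℂ (N := N) σ)

/-- Entries of the permutation matrix: `Π(σ)_{w', w} = [w = w' ∘ σ]`. [folklore] -/
theorem wordPermMatrix_apply (σ : Equiv.Perm (Fin n)) (w' w : Word N n) :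
    wordPermMatrix N σ w' w = if w = w' ∘ ⇑σ then 1 else 0 := by
  rw [wordPermMatrix, LinearMap.toMatrix'_apply, wordPerm_apply, Pi.single_apply]
  by_cases h : w = w' ∘ ⇑σ
  · rw [if_pos h, if_pos h.symm]
  · rw [if_neg h, if_neg (fun e => h e.symm)]

/-- The permutation matrix acts as `wordPerm`. [folklore] -/
theorem wordPermMatrix_mulVec (σ : Equiv.Perm (Fin n)) (c : Word N n → ℂ) :
    (wordPermMatrix N σ).mulVec c = wordPerm ℂ σ c := by
  rw [wordPermMatrix, LinearMap.toMatrix'_mulVec]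

/-- **The actions of `𝔖ₙ` and of every matrix `A` (by its Kronecker power) on `(ℂ^N)^{⊗n}`
commute**: `Π(σ) A^{⊗n} = A^{⊗n} Π(σ)` (Fulton–Harris Lemma 6.22; here for arbitrary, possibly
singular, `A`). [cite: FultonHarrisGTM129, Lemma 6.22] -/
theorem wordPermMatrix_mul_tensorPowerMatrix (σ : Equiv.Perm (Fin n))
    (A : Matrix (Fin N) (Fin N) ℂ) :
    wordPermMatrix N σ * tensorPowerMatrix ℂ N n A =
      tensorPowerMatrix ℂ N n A * wordPermMatrix N σ := by
  ext w' w
  simp only [Matrix.mul_apply, wordPermMatrix_apply, tensorPowerMatrix_apply, ite_mul, one_mul,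
    zero_mul, mul_ite, mul_one, mul_zero]
  rw [Finset.sum_ite_eq' Finset.univ (w' ∘ ⇑σ), if_pos (Finset.mem_univ _)]
  -- right-hand side: the only `v` with `w = v ∘ σ` is `v = w ∘ σ⁻¹`
  have hiff : ∀ v : Word N n, w = v ∘ ⇑σ ↔ v = w ∘ ⇑σ⁻¹ := by
    intro v
    constructor
    · rintro rfl
      funext p
      simp
    · rintro rfl
      funext p
      simp
  simp only [hiff]
  rw [Finset.sum_ite_eq' Finset.univ (w ∘ ⇑σ⁻¹), if_pos (Finset.mem_univ _)]
  -- `∏_p A (w' (σ p)) (w p) = ∏_p A (w' p) (w (σ⁻¹ p))`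
  exact Fintype.prod_equiv σ (fun p => A ((w' ∘ ⇑σ) p) (w p)) (fun p => A (w' p) ((w ∘ ⇑σ⁻¹) p))
    fun p => by simp

/-! ### The matrices `P_λ` -/

/-- The isotypic projector of `χ^λ` on `(ℂ^N)^{⊗n}` as a linear map of the word space: the
tree's `isotypicProj` of the position action `wordPermRep` of `𝔖ₙ` (CVZ §3.1, `P_λ^V`).
[cite: ChristandlVranaZuiddam2023, §3.1] -/
abbrev wordIsotypicProj (N n : ℕ) (lam : Nat.Partition n) : (Word N n → ℂ) →ₗ[ℂ] (Word N n → ℂ) :=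
  isotypicProj (wordPermRep ℂ N n) (spechtCharacter ℂ lam)

/-- **The isotypic projector `P_λ` of `𝔖ₙ` on `(ℂ^N)^{⊗n}` as a matrix** on words
(`= (f^λ/n!) ∑_t χ^λ(t) Π(t⁻¹)`, `wordIsotypicMatrix_eq_sum`).
[cite: ChristandlVranaZuiddam2023, §3.1] -/
def wordIsotypicMatrix (N n : ℕ) (lam : Nat.Partition n) : Matrix (Word N n) (Word N n) ℂ :=
  LinearMap.toMatrix' (wordIsotypicProj N n lam)

/-- `P_λ` acts as the isotypic projector. [cite: ChristandlVranaZuiddam2023, §3.1] -/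
theorem wordIsotypicMatrix_mulVec (lam : Nat.Partition n) (c : Word N n → ℂ) :
    (wordIsotypicMatrix N n lam).mulVec c = wordIsotypicProj N n lam c := by
  rw [wordIsotypicMatrix, LinearMap.toMatrix'_mulVec]

/-- **Character formula**: `P_λ = ∑_t (f^λ/n!) χ^λ(t) • Π(t⁻¹)` with `f^λ = χ^λ(1)`.
[cite: SerreLinearRepresentations1977, §2.6 Thm. 8] -/
theorem wordIsotypicMatrix_eq_sum (lam : Nat.Partition n) :
    wordIsotypicMatrix N n lam = ∑ t : Equiv.Perm (Fin n),
      (spechtCharacter ℂ lam 1 / Fintype.card (Equiv.Perm (Fin n)) * spechtCharacter ℂ lam t) •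
        wordPermMatrix N t⁻¹ := by
  have h : wordIsotypicProj N n lam = ∑ t : Equiv.Perm (Fin n),
      (spechtCharacter ℂ lam 1 / Fintype.card (Equiv.Perm (Fin n)) * spechtCharacter ℂ lam t) •
        wordPerm ℂ (N := N) t⁻¹ := by
    refine LinearMap.ext fun c => ?_
    rw [isotypicProj_apply, LinearMap.sum_apply]
    refine Finset.sum_congr rfl fun t _ => ?_
    rw [LinearMap.smul_apply, wordPermRep_apply]
  rw [wordIsotypicMatrix, h, map_sum]
  refine Finset.sum_congr rfl fun t _ => ?_
  rw [map_smul]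
  rfl

/-- Entries of `P_λ`: `(P_λ)_{w', w} = ∑_{t : w = w' ∘ t⁻¹} (f^λ/n!) χ^λ(t)`.
[cite: SerreLinearRepresentations1977, §2.6 Thm. 8] -/
theorem wordIsotypicMatrix_apply (lam : Nat.Partition n) (w' w : Word N n) :
    wordIsotypicMatrix N n lam w' w = ∑ t : Equiv.Perm (Fin n),
      if w = w' ∘ ⇑t⁻¹ then
        spechtCharacter ℂ lam 1 / Fintype.card (Equiv.Perm (Fin n)) * spechtCharacter ℂ lam t
      else 0 := by
  rw [wordIsotypicMatrix_eq_sum, Matrix.sum_apply]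
  refine Finset.sum_congr rfl fun t _ => ?_
  rw [Matrix.smul_apply, wordPermMatrix_apply, smul_eq_mul, mul_ite, mul_one, mul_zero]

/-- **`P_λ` commutes with the Kronecker power of every matrix**: `P_λ A^{⊗n} = A^{⊗n} P_λ`
(CVZ, proof of Lemma 3.6: "`P_λ^{W_S} (A_1 ⊗ ⋯ ⊗ A_k)^{⊗n} = (A_1 ⊗ ⋯ ⊗ A_k)^{⊗n} P_λ^{V_S}`").
[cite: ChristandlVranaZuiddam2023, Lemma 3.6] -/
theorem wordIsotypicMatrix_mul_tensorPowerMatrix (lam : Nat.Partition n)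
    (A : Matrix (Fin N) (Fin N) ℂ) :
    wordIsotypicMatrix N n lam * tensorPowerMatrix ℂ N n A =
      tensorPowerMatrix ℂ N n A * wordIsotypicMatrix N n lam := by
  rw [wordIsotypicMatrix_eq_sum, Finset.sum_mul, Finset.mul_sum]
  refine Finset.sum_congr rfl fun t _ => ?_
  rw [Matrix.smul_mul, Matrix.mul_smul, wordPermMatrix_mul_tensorPowerMatrix]

/-- `P_λ² = P_λ`. [cite: SerreLinearRepresentations1977, §2.6 Thm. 8] -/
theorem wordIsotypicMatrix_mul_self (lam : Nat.Partition n) :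
    wordIsotypicMatrix N n lam * wordIsotypicMatrix N n lam = wordIsotypicMatrix N n lam := by
  rw [wordIsotypicMatrix, ← LinearMap.toMatrix'_comp, isotypicProj_specht_comp_self]

/-- `P_λ P_μ = 0` for `λ ≠ μ`. [cite: SerreLinearRepresentations1977, §2.6 Thm. 8] -/
theorem wordIsotypicMatrix_mul_of_ne {lam μ : Nat.Partition n} (h : lam ≠ μ) :
    wordIsotypicMatrix N n lam * wordIsotypicMatrix N n μ = 0 := by
  rw [wordIsotypicMatrix, wordIsotypicMatrix, ← LinearMap.toMatrix'_comp,
    isotypicProj_specht_comp_of_ne _ h, map_zero]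

/-- **`∑_{λ ⊢ n} P_λ = 1`**. [cite: SerreLinearRepresentations1977, §2.6 Thm. 8] -/
theorem sum_wordIsotypicMatrix (N n : ℕ) :
    ∑ lam : Nat.Partition n, wordIsotypicMatrix N n lam = 1 := by
  simp only [wordIsotypicMatrix]
  rw [← map_sum, sum_isotypicProj_specht, LinearMap.toMatrix'_id]

/-- `P_λ` commutes with the permutation matrices.
[cite: SerreLinearRepresentations1977, §2.6 Thm. 8] -/
theorem wordIsotypicMatrix_mul_wordPermMatrix (lam : Nat.Partition n) (σ : Equiv.Perm (Fin n)) :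
    wordIsotypicMatrix N n lam * wordPermMatrix N σ =
      wordPermMatrix N σ * wordIsotypicMatrix N n lam := by
  rw [wordIsotypicMatrix, wordPermMatrix, ← LinearMap.toMatrix'_comp, ← LinearMap.toMatrix'_comp,
    ← wordPermRep_apply, isotypicProj_specht_comm]

/-! ### Self-adjointness and positivity -/

/-- `Π(σ)ᴴ = Π(σ⁻¹)`: permutation matrices are real orthogonal. [folklore] -/
theorem conjTranspose_wordPermMatrix (σ : Equiv.Perm (Fin n)) :
    (wordPermMatrix N σ)ᴴ = wordPermMatrix N σ⁻¹ := by
  ext w' w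
  rw [Matrix.conjTranspose_apply, wordPermMatrix_apply, wordPermMatrix_apply]
  have hiff : w' = w ∘ ⇑σ ↔ w = w' ∘ ⇑σ⁻¹ := by
    constructor
    · rintro rfl
      funext p
      simp
    · rintro rfl
      funext p
      simp
  by_cases h : w' = w ∘ ⇑σ
  · rw [if_pos h, if_pos (hiff.1 h), star_one]
  · rw [if_neg h, if_neg (fun e => h (hiff.2 e)), star_zero]

/-- **`P_λ` is self-adjoint**: `P_λᴴ = P_λ` (the coefficients `(f^λ/n!) χ^λ(t)` are real,
`χ^λ(t⁻¹) = χ^λ(t)` and `Π(t⁻¹)ᴴ = Π(t)`). [cite: SerreLinearRepresentations1977, §2.6 Thm. 8] -/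
theorem conjTranspose_wordIsotypicMatrix (lam : Nat.Partition n) :
    (wordIsotypicMatrix N n lam)ᴴ = wordIsotypicMatrix N n lam := by
  rw [wordIsotypicMatrix_eq_sum, Matrix.conjTranspose_sum]
  -- reindex the sum along `t ↦ t⁻¹`
  refine Fintype.sum_equiv (Equiv.inv (Equiv.Perm (Fin n))) _ _ fun t => ?_
  simp only [Equiv.inv_apply, inv_inv, Matrix.conjTranspose_smul, conjTranspose_wordPermMatrix]
  congr 1
  rw [star_mul', star_div₀, star_spechtCharacter, star_spechtCharacter, spechtCharacter_inv]
  congr 2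
  exact Complex.conj_natCast _

/-- `P_λ` is Hermitian. [cite: SerreLinearRepresentations1977, §2.6 Thm. 8] -/
theorem isHermitian_wordIsotypicMatrix (lam : Nat.Partition n) :
    (wordIsotypicMatrix N n lam).IsHermitian :=
  conjTranspose_wordIsotypicMatrix lam

/-- **`P_λ` is positive semidefinite** (`P_λ = P_λᴴ P_λ`). [folklore] -/
theorem posSemidef_wordIsotypicMatrix (lam : Nat.Partition n) :
    (wordIsotypicMatrix N n lam).PosSemidef := by
  have h : wordIsotypicMatrix N n lam =
      (wordIsotypicMatrix N n lam)ᴴ * wordIsotypicMatrix N n lam := by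
    rw [conjTranspose_wordIsotypicMatrix, wordIsotypicMatrix_mul_self]
  rw [h]
  exact Matrix.posSemidef_conjTranspose_mul_self _

/-- **`P_λ ≤ 1`**: `1 - P_λ` is positive semidefinite (it is again a self-adjoint idempotent).
[folklore] -/
theorem posSemidef_one_sub_wordIsotypicMatrix (lam : Nat.Partition n) :
    (1 - wordIsotypicMatrix N n lam).PosSemidef := by
  have hsq : (1 - wordIsotypicMatrix N n lam) * (1 - wordIsotypicMatrix N n lam) =
      1 - wordIsotypicMatrix N n lam := by
    rw [Matrix.sub_mul, Matrix.mul_sub, Matrix.mul_sub, Matrix.one_mul, Matrix.one_mul,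
      Matrix.mul_one, wordIsotypicMatrix_mul_self, sub_self, sub_zero]
  have hH : (1 - wordIsotypicMatrix N n lam)ᴴ = 1 - wordIsotypicMatrix N n lam := by
    rw [Matrix.conjTranspose_sub, Matrix.conjTranspose_one, conjTranspose_wordIsotypicMatrix]
  have h : 1 - wordIsotypicMatrix N n lam =
      (1 - wordIsotypicMatrix N n lam)ᴴ * (1 - wordIsotypicMatrix N n lam) := by
    rw [hH, hsq]
  rw [h]
  exact Matrix.posSemidef_conjTranspose_mul_self _

end Literature.RepresentationTheory.FiniteGroups

end
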